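import Summits.QuantumFields.BalabanUV.Beta.FP.BlockAveragedKernelLegs

/-!
# Road FP (binder row D1), row H′2-IR ∕ IR-1-ABS — PART 6: THE WINDOW-SUMMED (ℓ¹) DIFFERENCE LETTERS OF A BLOCK AVERAGE — THE AVERAGED (D2)
# WITHOUT THE EDGE LOGARITHM (owner's R-FP-20 (c): «deliver (D2)∕(T2) in BOTH forms: sup with the honest log AND the block∕window-averaged form
# without it — the latter being the consumer's letter»; our bookkeeping, no estimate of any propagator)

HONEST DEPENDENCY (page 1, mandatory): continuum YM on T⁴ ⇐ BetaPertH ∧ nine spine estimates (0/9 proved); BetaPertH ⇐ (D1) ∧ (D4) ∧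
CAP+tail; G-an2-4 gates asym, D1 and NE2/3/4.  HONEST FRAMING (cell contract, verbatim): «discharging `BetaPertH` makes Bałaban's UV
stability UNCONDITIONAL — a real constructive-QFT result; it is NOT the continuum limit and NOT the Clay problem.»  THIS MODULE is
elementary real analysis on finite sums over `ℤ⁴` (our bookkeeping): it cites nothing, mints no `def … : Prop`, declares no data `def`,
has 0 `sorry`.  It discharges NOTHING of row H′2-IR, of `hasym`, of D1 or of `BetaPertH`; NOT (CONV-C), NOT D1, NOT the continuum limit, NOT Clay.

ABSOLUTE RULE (cell charter, verbatim): «No internally-minted statement may enter as a cited fact. Every hypothesis is either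
kernel-proved in this package or a verbatim quotation of a PUBLISHED theorem with page reference. The manuscript(s) under audit are NOT
citable for their own disputed steps — they are the thing under adjudication; programme-internal (2001/route/tribunal) claims are never
citable.»

WHY (R-FP-20, after this seat's located edge logarithm): the SUP letter for the second differences of a block-averaged degree-2 leg carries a
genuine `log n` at block-edge-adjacent points (PART 4 (ii″) ∕ PART 5 §4 state it WITH the log), but the M₂ bookkeeping consumes WINDOW SUMS
`Σ_{‖x‖≤R}|Δ_μΔ_ν(…)|`, and there the edge layer (codimension 2, relative volume `≍ n⁻²`) integrates its logarithm away.  MECHANISM (discrete,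
exact): one difference is moved onto the flat block weight by SUMMATION BY PARTS — `Σ_s w(s)(Q(p+e−s) − Q(p−s)) = Σ_s (w(s) − w(s−e))·Q(p+e−s)` —
and the difference weight of the flat block `n⁻⁴𝟙_{fineBlock n}` lives on the two faces crossed by `e` (`2n³` points, flatness `n⁻⁴`: MASS `2∕n`);
the other difference stays on the kernel (degree `3`, sub-marginal); a WINDOW sum then costs the mass times a degree-3 shell sum — NO logarithm.

CONTENT.
* §1 `sum_box_abs_blockSum_le_mass_mul` (WINDOW FUBINI: `Σ_{p∈box R}|Σ_{s∈box ρ′} v s·Q(p + c − s)| ≤ (Σ|v|)·Σ_{z∈box(R+ρ′+‖c‖∞)}|Q z|`),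
  `sum_box_abs_le_of_letter` (`Σ_{z∈box M}|Q z| ≤ A·81(M+1)^{4−a}`, `a ≤ 3`).
* §2 `blockSum_shift_sub_eq_sum_diffWeight` (SUMMATION BY PARTS for block sums over `box ρ`, shift `‖e‖∞ ≤ 1`).
* §3 the flat block's difference weight: `indicator_box_fineBlock`, `abs_blockDiffWeight_le_indicator` (supported on the two `e_ν`-faces, `≤ n⁻⁴` there),
  `card_faces_le` (`≤ 2n³`), **`sum_abs_blockDiffWeight_le`** (mass `≤ 2∕n`).
* §4 **`sum_box_abs_blockAvg_fwdDiff_le_window`** (`|Q z| ≤ A∕(‖z‖∞+1)^a`, `a ≤ 3`, `n ≥ 1`, every `R`):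
  `Σ_{p ∈ box R} |n⁻⁴·blockSum n (y ↦ Q(n•u + p + e_ν − y)) u − n⁻⁴·blockSum n (y ↦ Q(n•u + p − y)) u| ≤ (2∕n)·A·81·(R + n + 3)^{4−a}`;
  **`sum_box_abs_blockAvg_fwdDiff₂_le_window`** = THE AVERAGED (D2): with the first-difference letter `|P(z+e_μ) − P z| ≤ C₁∕(‖z‖∞+1)³` (ALL `μ, ν`,
  diagonal included): `Σ_{p ∈ box R} |Δ_νΔ_μ-second difference of the block average at n•u + p| ≤ 162·C₁·(R + n + 3)∕n`, and at the doubled block `R = n`: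
  **`≤ 810·C₁`** = `(count ≍ n⁴) × O(C₁·n⁻⁴)` — LOG-FREE (`sum_box_abs_blockAvg_fwdDiff₂_le_doubledBlock`); the free leg `latticeGreen∕2` unconditionally
  (`sum_box_abs_blockAvg_free_fwdDiff₂_le_doubledBlock`, `C₁ := 8(2U₀+2c₄+Bgrad₀)` from PART 5).
Unit `b2b-balaban-gan24-formalise-leaf-04` (gen 39, idle G-an2-4 swarm leaf seat, cross-lane), 2026-08-20; `LEAVES-FP.md` rows IR-1-ABS ∕ IR-1-GEN; R-FP-20 (c).
-/

noncomputable section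

namespace Summit.QuantumFields.BalabanUV.Beta.FP.BlockAveragedKernelWindow

open Finset
open scoped BigOperators
open Literature.Probability.LatticeModels (box mem_box box_mono zero_mem_box latticeGreen)
open Literature.MathematicalPhysics.QuantumFieldTheory.Balaban1983to89.Beta.DyadicShell
  (Pt supNorm supNorm_le_iff natAbs_le_supNorm mem_box_iff supNorm_eq_zero_iff)
open Literature.MathematicalPhysics.QuantumFieldTheory.Balaban1983to89.Beta.BubbleTransfer (c4 unitVec)
open Literature.MathematicalPhysics.QuantumFieldTheory.Balaban1983to89.Beta.TwoPowerLegs (TwoPower free supNorm_unitVec)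
open Literature.MathematicalPhysics.QuantumFieldTheory.Balaban1983to89.Beta.AxialBlockWeights (fineBlock mem_fineBlock card_fineBlock)
open Literature.MathematicalPhysics.QuantumFieldTheory.Balaban1983to89.Beta.AffineAveraging (blockSum)
open Summit.QuantumFields.BalabanUV.Beta.FP.BlockAveragedKernel
open Summit.QuantumFields.BalabanUV.Beta.FP.BlockAveragedKernelScalar
open Summit.QuantumFields.BalabanUV.Beta.FP.BlockAveragedKernelLegs

/-! ## §1 Window Fubini and the shell sum of a kernel's absolute value -/

/-- **WINDOW FUBINI.**  Summing the absolute value of a block sum over a window `box R` of positions costs the weight's MASS times ONE sum of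
`|Q|` over the enlarged box `box (R + ρ′ + ‖c‖∞)`:
`Σ_{p ∈ box R} |Σ_{s ∈ box ρ′} v s·Q(p + c − s)| ≤ (Σ_{s∈box ρ′}|v s|)·Σ_{z ∈ box (R+ρ′+‖c‖∞)} |Q z|`. [our bookkeeping] -/
theorem sum_box_abs_blockSum_le_mass_mul (v Q : Pt → ℝ) (ρ' R : ℕ) (c : Pt) :
    ∑ p ∈ box 4 R, |∑ s ∈ box 4 ρ', v s * Q (p + c - s)|
      ≤ (∑ s ∈ box 4 ρ', |v s|) * ∑ z ∈ box 4 (R + ρ' + supNorm c), |Q z| := by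
  -- the translated window lands in the enlarged box, for every `s` in the weight's box
  have hinner : ∀ s ∈ box 4 ρ', ∑ p ∈ box 4 R, |Q (p + c - s)| ≤ ∑ z ∈ box 4 (R + ρ' + supNorm c), |Q z| := by
    intro s hs
    have hinj : Set.InjOn (fun p : Pt => p + c - s) (box 4 R : Set Pt) := fun p _ q _ h => by
      simpa using congrArg (fun t => t + s - c) h
    have hsub : (box 4 R).image (fun p => p + c - s) ⊆ box 4 (R + ρ' + supNorm c) := by
      intro t ht
      obtain ⟨p, hp, rfl⟩ := mem_image.mp ht
      rw [mem_box_iff] at hp hs ⊢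
      have h1 := supNorm_sub_le_nat (p + c) s
      have h2 := supNorm_add_le_nat p c
      omega
    calc ∑ p ∈ box 4 R, |Q (p + c - s)| = ∑ z ∈ (box 4 R).image (fun p => p + c - s), |Q z| := by
          rw [sum_image (fun p hp q hq h => hinj hp hq h)]
      _ ≤ ∑ z ∈ box 4 (R + ρ' + supNorm c), |Q z| := sum_le_sum_of_subset_of_nonneg hsub fun _ _ _ => abs_nonneg _
  calc ∑ p ∈ box 4 R, |∑ s ∈ box 4 ρ', v s * Q (p + c - s)|
      ≤ ∑ p ∈ box 4 R, ∑ s ∈ box 4 ρ', |v s| * |Q (p + c - s)| :=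
        sum_le_sum fun p _ => (abs_sum_le_sum_abs _ _).trans (le_of_eq (sum_congr rfl fun s _ => abs_mul _ _))
    _ = ∑ s ∈ box 4 ρ', |v s| * ∑ p ∈ box 4 R, |Q (p + c - s)| := by rw [sum_comm]; simp_rw [mul_sum]
    _ ≤ ∑ s ∈ box 4 ρ', |v s| * ∑ z ∈ box 4 (R + ρ' + supNorm c), |Q z| :=
        sum_le_sum fun s hs => mul_le_mul_of_nonneg_left (hinner s hs) (abs_nonneg _)
    _ = (∑ s ∈ box 4 ρ', |v s|) * ∑ z ∈ box 4 (R + ρ' + supNorm c), |Q z| := by rw [sum_mul]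

/-- [our bookkeeping] The shell sum of a sub-marginal kernel's absolute value: `Σ_{z ∈ box M}|Q z| ≤ A·81·(M+1)^{4−a}` (`a ≤ 3`). -/
theorem sum_box_abs_le_of_letter {Q : Pt → ℝ} {A : ℝ} {a : ℕ} (ha : a ≤ 3) (hQ : ∀ z, |Q z| ≤ A / ((supNorm z : ℝ) + 1) ^ a)
    (M : ℕ) : ∑ z ∈ box 4 M, |Q z| ≤ A * (81 * ((M : ℝ) + 1) ^ (4 - a)) := by
  have hA := letter_nonneg_of_le hQ
  calc ∑ z ∈ box 4 M, |Q z| ≤ ∑ z ∈ box 4 M, A * (1 / ((supNorm z : ℝ) + 1) ^ a) :=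
        sum_le_sum fun z _ => (hQ z).trans (le_of_eq (by rw [mul_one_div]))
    _ = A * ∑ z ∈ box 4 M, 1 / ((supNorm z : ℝ) + 1) ^ a := by rw [mul_sum]
    _ ≤ A * (81 * ((M : ℝ) + 1) ^ (4 - a)) := mul_le_mul_of_nonneg_left (sum_box_inv_pow_succ_le ha M) hA

/-! ## §2 Summation by parts for block sums -/

/-- **SUMMATION BY PARTS.**  For a weight read on `box ρ` and a unit shift `‖e‖∞ ≤ 1`:
`Σ_{s∈box ρ} w s·Q(p + e − s) − Σ_{s∈box ρ} w s·Q(p − s) = Σ_{s ∈ box (ρ+1)} (𝟙w(s) − 𝟙w(s − e))·Q(p + e − s)`, `𝟙w := w·𝟙_{box ρ}` —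
the position difference of the block sum is the block sum, over the one-larger box, of the DIFFERENCE WEIGHT. [our bookkeeping] -/
theorem blockSum_shift_sub_eq_sum_diffWeight (w Q : Pt → ℝ) (ρ : ℕ) (p e : Pt) (he : supNorm e ≤ 1) :
    ∑ s ∈ box 4 ρ, w s * Q (p + e - s) - ∑ s ∈ box 4 ρ, w s * Q (p - s)
      = ∑ s ∈ box 4 (ρ + 1), ((if s ∈ box 4 ρ then w s else 0) - (if s - e ∈ box 4 ρ then w (s - e) else 0)) * Q (p + e - s) := by
  have hsub : box 4 ρ ⊆ box 4 (ρ + 1) := box_mono 4 (Nat.le_succ ρ)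
  -- first piece: the indicator restricts the larger box back to `box ρ`
  have h1 : ∑ s ∈ box 4 (ρ + 1), (if s ∈ box 4 ρ then w s else 0) * Q (p + e - s) = ∑ s ∈ box 4 ρ, w s * Q (p + e - s) := by
    rw [← sum_subset hsub (fun s _ hs => by rw [if_neg hs, zero_mul])]
    exact sum_congr rfl fun s hs => by rw [if_pos hs]
  -- second piece: re-index `s = t + e`; the shifted box `box ρ + e` sits inside `box (ρ+1)`
  have h2 : ∑ s ∈ box 4 (ρ + 1), (if s - e ∈ box 4 ρ then w (s - e) else 0) * Q (p + e - s) = ∑ t ∈ box 4 ρ, w t * Q (p - t) := by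
    have hmap : (box 4 ρ).map (Equiv.addRight e).toEmbedding ⊆ box 4 (ρ + 1) := by
      intro s hs
      rw [mem_map] at hs
      obtain ⟨t, ht, rfl⟩ := hs
      simp only [Equiv.coe_toEmbedding, Equiv.coe_addRight]
      rw [mem_box_iff] at ht ⊢
      have := supNorm_add_le_nat t e
      omega
    rw [← sum_subset hmap (fun s _ hs => ?_)]
    · rw [sum_map]
      refine sum_congr rfl fun t ht => ?_
      simp only [Equiv.coe_toEmbedding, Equiv.coe_addRight, add_sub_cancel_right, if_pos ht]
      congr 2; abel
    · have hse : s - e ∉ box 4 ρ := by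
        intro h
        exact hs (mem_map.mpr ⟨s - e, h, by simp⟩)
      rw [if_neg hse, zero_mul]
  simp only [sub_mul, sum_sub_distrib, h1, h2]

/-! ## §3 The flat block's difference weight: two faces, mass `2∕n` -/

/-- [our bookkeeping] `fineBlock n ⊆ box 4 n`, as an indicator identity. -/
theorem indicator_box_fineBlock (n : ℕ) (c : ℝ) (s : Pt) :
    (if s ∈ box 4 n then (if s ∈ fineBlock n then c else 0) else 0) = (if s ∈ fineBlock n then c else 0) := by
  by_cases hs : s ∈ box 4 n
  · rw [if_pos hs]
  · rw [if_neg hs, if_neg (fun h => hs (fineBlock_subset_box n h))]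

/-- **THE DIFFERENCE WEIGHT LIVES ON THE TWO FACES CROSSED BY `e_ν`.**  For the flat block weight `n⁻⁴𝟙_{fineBlock n}`:
`|𝟙w(s) − 𝟙w(s − e_ν)| ≤ n⁻⁴·𝟙[s_ν ∈ {0, n}, 0 ≤ s_j < n (j ≠ ν)]`. [our bookkeeping] -/
theorem abs_blockDiffWeight_le_indicator (n : ℕ) (ν : Fin 4) (s : Pt) :
    |(if s ∈ fineBlock n then ((n : ℝ) ^ 4)⁻¹ else 0) - (if s - Pi.single ν 1 ∈ fineBlock n then ((n : ℝ) ^ 4)⁻¹ else 0)|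
      ≤ ((n : ℝ) ^ 4)⁻¹ * (if s ∈ Fintype.piFinset (fun j : Fin 4 => if j = ν then ({0, (n : ℤ)} : Finset ℤ) else Finset.Ico (0 : ℤ) n)
          then 1 else 0) := by
  set F := Fintype.piFinset (fun j : Fin 4 => if j = ν then ({0, (n : ℤ)} : Finset ℤ) else Finset.Ico (0 : ℤ) n) with hFdef
  have hc : 0 ≤ ((n : ℝ) ^ 4)⁻¹ := by positivity
  have hcoord : ∀ j, (s - (Pi.single ν 1 : Pt)) j = s j - if j = ν then 1 else 0 := by
    intro j; simp [Pi.sub_apply, Pi.single_apply]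
  have hcν : (s - (Pi.single ν 1 : Pt)) ν = s ν - 1 := by rw [hcoord, if_pos rfl]
  have hcj : ∀ j, j ≠ ν → (s - (Pi.single ν 1 : Pt)) j = s j := by
    intro j hj; rw [hcoord, if_neg hj, sub_zero]
  -- membership in the two faces from the coordinates
  have hFmem : (∀ j, j ≠ ν → 0 ≤ s j ∧ s j < n) → (s ν = 0 ∨ s ν = n) → s ∈ F := by
    intro hoth hν
    rw [hFdef, Fintype.mem_piFinset]
    intro i
    by_cases hi : i = ν
    · rw [if_pos hi, Finset.mem_insert, Finset.mem_singleton, hi]; exact hν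
    · rw [if_neg hi, Finset.mem_Ico]; exact hoth i hi
  by_cases h1 : s ∈ fineBlock n <;> by_cases h2 : s - (Pi.single ν 1 : Pt) ∈ fineBlock n
  · rw [if_pos h1, if_pos h2, sub_self, abs_zero]; positivity
  · -- leaving face: `s_ν = 0`
    rw [if_pos h1, if_neg h2, sub_zero, abs_of_nonneg hc]
    have hF : s ∈ F := by
      rw [mem_fineBlock] at h1 h2
      obtain ⟨j, hj⟩ := not_forall.mp h2
      refine hFmem (fun i _ => h1 i) (Or.inl ?_)
      by_cases hjν : j = ν
      · rw [hjν, hcν] at hj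
        have := h1 ν
        omega
      · rw [hcj j hjν] at hj
        exact absurd (h1 j) hj
    rw [if_pos hF, mul_one]
  · -- entering face: `s_ν = n`
    rw [if_neg h1, if_pos h2, zero_sub, abs_neg, abs_of_nonneg hc]
    have hF : s ∈ F := by
      rw [mem_fineBlock] at h1 h2
      obtain ⟨j, hj⟩ := not_forall.mp h1
      have hν := h2 ν
      rw [hcν] at hν
      refine hFmem (fun i hi => by have h := h2 i; rw [hcj i hi] at h; exact h) (Or.inr ?_)
      by_cases hjν : j = ν
      · rw [hjν] at hj
        omega
      · have h := h2 j
        rw [hcj j hjν] at h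
        exact absurd h hj
    rw [if_pos hF, mul_one]
  · rw [if_neg h1, if_neg h2, sub_self, abs_zero]; positivity

/-- [our bookkeeping] The two faces have `≤ 2n³` points. -/
theorem card_faces_le (n : ℕ) (ν : Fin 4) :
    ((Fintype.piFinset (fun j : Fin 4 => if j = ν then ({0, (n : ℤ)} : Finset ℤ) else Finset.Ico (0 : ℤ) n)).card : ℝ)
      ≤ 2 * (n : ℝ) ^ 3 := by
  rw [Fintype.card_piFinset]
  push_cast
  have hpair : (({0, (n : ℤ)} : Finset ℤ).card : ℝ) ≤ 2 := by exact_mod_cast Finset.card_le_two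
  have hIco : ((Finset.Ico (0 : ℤ) n).card : ℝ) = n := by rw [Int.card_Ico]; simp
  have hn0 : (0 : ℝ) ≤ n := Nat.cast_nonneg n
  rw [← Finset.mul_prod_erase (Finset.univ : Finset (Fin 4))
    (fun j => (((if j = ν then ({0, (n : ℤ)} : Finset ℤ) else Finset.Ico (0 : ℤ) n).card : ℕ) : ℝ)) (Finset.mem_univ ν)]
  have hrest : ∏ j ∈ (Finset.univ : Finset (Fin 4)).erase ν,
      (((if j = ν then ({0, (n : ℤ)} : Finset ℤ) else Finset.Ico (0 : ℤ) n).card : ℕ) : ℝ) = (n : ℝ) ^ 3 := by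
    rw [Finset.prod_congr rfl (fun j hj => by rw [if_neg (Finset.ne_of_mem_erase hj), hIco]), Finset.prod_const,
      Finset.card_erase_of_mem (Finset.mem_univ ν), Finset.card_univ, Fintype.card_fin]
  rw [hrest, if_pos rfl]
  exact mul_le_mul_of_nonneg_right hpair (by positivity)

/-- **MASS OF THE DIFFERENCE WEIGHT: `≤ 2∕n`.**  `Σ_{s ∈ box (n+1)} |𝟙w(s) − 𝟙w(s − e_ν)| ≤ 2∕n` for the flat block weight `n⁻⁴𝟙_{fineBlock n}`, `n ≥ 1`.
[our bookkeeping] -/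
theorem sum_abs_blockDiffWeight_le {n : ℕ} (hn : 1 ≤ n) (ν : Fin 4) :
    ∑ s ∈ box 4 (n + 1), |(if s ∈ fineBlock n then ((n : ℝ) ^ 4)⁻¹ else 0) - (if s - Pi.single ν 1 ∈ fineBlock n then ((n : ℝ) ^ 4)⁻¹ else 0)|
      ≤ 2 / (n : ℝ) := by
  set F := Fintype.piFinset (fun j : Fin 4 => if j = ν then ({0, (n : ℤ)} : Finset ℤ) else Finset.Ico (0 : ℤ) n) with hF
  have hn' : (0 : ℝ) < n := by exact_mod_cast hn
  calc ∑ s ∈ box 4 (n + 1), |(if s ∈ fineBlock n then ((n : ℝ) ^ 4)⁻¹ else 0)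
          - (if s - Pi.single ν 1 ∈ fineBlock n then ((n : ℝ) ^ 4)⁻¹ else 0)|
      ≤ ∑ s ∈ box 4 (n + 1), ((n : ℝ) ^ 4)⁻¹ * (if s ∈ F then 1 else 0) :=
        sum_le_sum fun s _ => abs_blockDiffWeight_le_indicator n ν s
    _ = ((n : ℝ) ^ 4)⁻¹ * ((box 4 (n + 1) ∩ F).card : ℝ) := by
        rw [← mul_sum, Finset.sum_ite_mem, sum_const, nsmul_eq_mul, mul_one]
    _ ≤ ((n : ℝ) ^ 4)⁻¹ * (F.card : ℝ) := by
        gcongr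
        exact Finset.inter_subset_right
    _ ≤ ((n : ℝ) ^ 4)⁻¹ * (2 * (n : ℝ) ^ 3) := mul_le_mul_of_nonneg_left (card_faces_le n ν) (by positivity)
    _ = 2 / (n : ℝ) := by field_simp

/-! ## §4 The window-summed difference letters — the averaged (D2), log-free -/

/-- [our bookkeeping] `blockSum` is additive in the averaged function (pointwise difference). -/
theorem blockSum_sub (n : ℕ) (f g : Pt → ℝ) (u : Pt) :
    blockSum n (fun y => f y - g y) u = blockSum n f u - blockSum n g u := by
  unfold blockSum
  exact sum_sub_distrib _ _

/-- **THE WINDOW-SUMMED FIRST-DIFFERENCE LETTER OF THE SCALAR BLOCK AVERAGE.**  `|Q z| ≤ A∕(‖z‖∞+1)^a`, `a ≤ 3`, `n ≥ 1`: for every window radius `R`,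
`Σ_{p ∈ box R} |n⁻⁴·blockSum n (y ↦ Q(n•u + p + e_ν − y)) u − n⁻⁴·blockSum n (y ↦ Q(n•u + p − y)) u| ≤ (2∕n)·A·81·(R + n + 3)^{4−a}`
— summation by parts (§2) puts the difference on the weight (mass `2∕n`, §3), window Fubini (§1) pays one degree-`a` shell sum. [our bookkeeping] -/
theorem sum_box_abs_blockAvg_fwdDiff_le_window {Q : Pt → ℝ} {A : ℝ} {a : ℕ} (ha : a ≤ 3)
    (hQ : ∀ z, |Q z| ≤ A / ((supNorm z : ℝ) + 1) ^ a) {n : ℕ} (hn : 1 ≤ n) (ν : Fin 4) (u : Pt) (R : ℕ) :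
    ∑ p ∈ box 4 R, |((n : ℝ) ^ 4)⁻¹ * blockSum n (fun y => Q (n • u + p + Pi.single ν 1 - y)) u
        - ((n : ℝ) ^ 4)⁻¹ * blockSum n (fun y => Q (n • u + p - y)) u|
      ≤ 2 / (n : ℝ) * (A * (81 * ((((R + (n + 1) + 1 : ℕ) : ℝ)) + 1) ^ (4 - a))) := by
  have hA := letter_nonneg_of_le hQ
  have he : supNorm (Pi.single ν 1 : Pt) ≤ 1 := by
    rw [show (Pi.single ν 1 : Pt) = unitVec ν from rfl, supNorm_unitVec]
  -- per position: block sums over `box n` against the flat weight, then summation by parts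
  have hp : ∀ p : Pt,
      ((n : ℝ) ^ 4)⁻¹ * blockSum n (fun y => Q (n • u + p + Pi.single ν 1 - y)) u
        - ((n : ℝ) ^ 4)⁻¹ * blockSum n (fun y => Q (n • u + p - y)) u
      = ∑ s ∈ box 4 (n + 1), ((if s ∈ fineBlock n then ((n : ℝ) ^ 4)⁻¹ else 0)
          - (if s - Pi.single ν 1 ∈ fineBlock n then ((n : ℝ) ^ 4)⁻¹ else 0)) * Q (p + Pi.single ν 1 - s) := by
    intro p
    rw [blockAvg_eq_boxSum, blockAvg_eq_boxSum]
    have e1 : ∀ m ∈ box 4 n, (if m ∈ fineBlock n then ((n : ℝ) ^ 4)⁻¹ else 0) * Q (n • u + p + Pi.single ν 1 - (n • u + m))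
        = (if m ∈ fineBlock n then ((n : ℝ) ^ 4)⁻¹ else 0) * Q (p + Pi.single ν 1 - m) := by
      intro m _; congr 2; abel
    have e2 : ∀ m ∈ box 4 n, (if m ∈ fineBlock n then ((n : ℝ) ^ 4)⁻¹ else 0) * Q (n • u + p - (n • u + m))
        = (if m ∈ fineBlock n then ((n : ℝ) ^ 4)⁻¹ else 0) * Q (p - m) := by
      intro m _; congr 2; abel
    rw [sum_congr rfl e1, sum_congr rfl e2,
      blockSum_shift_sub_eq_sum_diffWeight (fun m => if m ∈ fineBlock n then ((n : ℝ) ^ 4)⁻¹ else 0) Q n p (Pi.single ν 1) he]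
    refine sum_congr rfl fun s _ => ?_
    rw [indicator_box_fineBlock, indicator_box_fineBlock]
  simp_rw [hp]
  refine (sum_box_abs_blockSum_le_mass_mul _ Q (n + 1) R (Pi.single ν 1)).trans ?_
  have hmass := sum_abs_blockDiffWeight_le hn ν
  have hshell := sum_box_abs_le_of_letter ha hQ (R + (n + 1) + supNorm (Pi.single ν 1 : Pt))
  have he1 : supNorm (Pi.single ν 1 : Pt) = 1 := by
    rw [show (Pi.single ν 1 : Pt) = unitVec ν from rfl, supNorm_unitVec]
  rw [he1] at hshell ⊢
  exact mul_le_mul hmass hshell (sum_nonneg fun _ _ => abs_nonneg _) (by positivity)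

/-- **THE AVERAGED (D2) — WINDOW-SUMMED SECOND DIFFERENCES, NO LOGARITHM** (ALL `μ, ν`, the diagonal included).  With the first-difference letter
`|P(z + e_μ) − P z| ≤ C₁∕(‖z‖∞+1)³`, `n ≥ 1`, every window radius `R`, writing `F(x) := n⁻⁴·blockSum n (y ↦ P(x − y)) u`:
`Σ_{p ∈ box R} |F(n•u+p+e_ν+e_μ) − F(n•u+p+e_ν) − F(n•u+p+e_μ) + F(n•u+p)| ≤ 162·C₁·(R + n + 3)∕n`. [our bookkeeping] -/
theorem sum_box_abs_blockAvg_fwdDiff₂_le_window {P : Pt → ℝ} {C₁ : ℝ} (μ ν : Fin 4)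
    (hΔ : ∀ z, |P (z + Pi.single μ 1) - P z| ≤ C₁ / ((supNorm z : ℝ) + 1) ^ 3) {n : ℕ} (hn : 1 ≤ n) (u : Pt) (R : ℕ) :
    ∑ p ∈ box 4 R, |((n : ℝ) ^ 4)⁻¹ * blockSum n (fun y => P (n • u + p + Pi.single ν 1 + Pi.single μ 1 - y)) u
        - ((n : ℝ) ^ 4)⁻¹ * blockSum n (fun y => P (n • u + p + Pi.single ν 1 - y)) u
        - ((n : ℝ) ^ 4)⁻¹ * blockSum n (fun y => P (n • u + p + Pi.single μ 1 - y)) u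
        + ((n : ℝ) ^ 4)⁻¹ * blockSum n (fun y => P (n • u + p - y)) u|
      ≤ 162 * C₁ * ((((R + (n + 1) + 1 : ℕ) : ℝ)) + 1) / n := by
  have hC := letter_nonneg_of_le (K := fun z => P (z + Pi.single μ 1) - P z) hΔ
  have hn' : (0 : ℝ) < n := by exact_mod_cast hn
  -- the first-difference kernel `Q := Δ_μ P` and the additivity of the block sum
  have h := sum_box_abs_blockAvg_fwdDiff_le_window (a := 3) le_rfl (Q := fun z => P (z + Pi.single μ 1) - P z) hΔ hn ν u R
  have e : ∀ p : Pt,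
      ((n : ℝ) ^ 4)⁻¹ * blockSum n (fun y => P (n • u + p + Pi.single ν 1 - y + Pi.single μ 1) - P (n • u + p + Pi.single ν 1 - y)) u
        - ((n : ℝ) ^ 4)⁻¹ * blockSum n (fun y => P (n • u + p - y + Pi.single μ 1) - P (n • u + p - y)) u
      = ((n : ℝ) ^ 4)⁻¹ * blockSum n (fun y => P (n • u + p + Pi.single ν 1 + Pi.single μ 1 - y)) u
        - ((n : ℝ) ^ 4)⁻¹ * blockSum n (fun y => P (n • u + p + Pi.single ν 1 - y)) u
        - ((n : ℝ) ^ 4)⁻¹ * blockSum n (fun y => P (n • u + p + Pi.single μ 1 - y)) u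
        + ((n : ℝ) ^ 4)⁻¹ * blockSum n (fun y => P (n • u + p - y)) u := by
    intro p
    rw [blockSum_sub, blockSum_sub]
    have e1 : blockSum n (fun y => P (n • u + p + Pi.single ν 1 - y + Pi.single μ 1)) u
        = blockSum n (fun y => P (n • u + p + Pi.single ν 1 + Pi.single μ 1 - y)) u := by
      unfold blockSum; exact sum_congr rfl fun b _ => congrArg P (by abel)
    have e2 : blockSum n (fun y => P (n • u + p - y + Pi.single μ 1)) u
        = blockSum n (fun y => P (n • u + p + Pi.single μ 1 - y)) u := by
      unfold blockSum; exact sum_congr rfl fun b _ => congrArg P (by abel)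
    rw [e1, e2]; ring
  simp_rw [e] at h
  refine h.trans (le_of_eq ?_)
  rw [show (4 - 3 : ℕ) = 1 from rfl, pow_one]
  field_simp
  ring

/-- **THE AVERAGED (D2) ON THE DOUBLED BLOCK: `≤ 810·C₁`, NO LOGARITHM** — at window radius `R = n` the `(2n+1)⁴ ≍ n⁴` positions carry a TOTAL
second-difference mass `O(C₁)`, i.e. `O(C₁·n⁻⁴)` on average: the consumer's letter of R-FP-20 (c).  (The sup letter, PART 4 (ii″), keeps its
honest `log n`.) [our bookkeeping] -/
theorem sum_box_abs_blockAvg_fwdDiff₂_le_doubledBlock {P : Pt → ℝ} {C₁ : ℝ} (μ ν : Fin 4)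
    (hΔ : ∀ z, |P (z + Pi.single μ 1) - P z| ≤ C₁ / ((supNorm z : ℝ) + 1) ^ 3) {n : ℕ} (hn : 1 ≤ n) (u : Pt) :
    ∑ p ∈ box 4 n, |((n : ℝ) ^ 4)⁻¹ * blockSum n (fun y => P (n • u + p + Pi.single ν 1 + Pi.single μ 1 - y)) u
        - ((n : ℝ) ^ 4)⁻¹ * blockSum n (fun y => P (n • u + p + Pi.single ν 1 - y)) u
        - ((n : ℝ) ^ 4)⁻¹ * blockSum n (fun y => P (n • u + p + Pi.single μ 1 - y)) u
        + ((n : ℝ) ^ 4)⁻¹ * blockSum n (fun y => P (n • u + p - y)) u|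
      ≤ 810 * C₁ := by
  have hC := letter_nonneg_of_le (K := fun z => P (z + Pi.single μ 1) - P z) hΔ
  have hn' : (1 : ℝ) ≤ n := by exact_mod_cast hn
  have hn0 : (0 : ℝ) < n := by linarith
  refine (sum_box_abs_blockAvg_fwdDiff₂_le_window μ ν hΔ hn u n).trans ?_
  rw [div_le_iff₀ hn0]
  push_cast
  nlinarith

/-- **THE AVERAGED (D2) FOR THE FREE LEG `G₀ = latticeGreen∕2`, UNCONDITIONALLY** (PART 5's `letterDiff_free`): on the doubled block the window sum of
the second differences of `n⁻⁴·blockSum n (y ↦ G₀(· − y)) u` is `≤ 810·8(2U₀ + 2c₄ + Bgrad₀)` — IR-4's (T2) input at level 0 in the consumer's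
(window-ℓ¹) currency. [our bookkeeping] -/
theorem sum_box_abs_blockAvg_free_fwdDiff₂_le_doubledBlock (μ ν : Fin 4) {n : ℕ} (hn : 1 ≤ n) (u : Pt) :
    ∑ p ∈ box 4 n, |((n : ℝ) ^ 4)⁻¹ * blockSum n (fun y => latticeGreen (n • u + p + Pi.single ν 1 + Pi.single μ 1 - y) / 2) u
        - ((n : ℝ) ^ 4)⁻¹ * blockSum n (fun y => latticeGreen (n • u + p + Pi.single ν 1 - y) / 2) u
        - ((n : ℝ) ^ 4)⁻¹ * blockSum n (fun y => latticeGreen (n • u + p + Pi.single μ 1 - y) / 2) u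
        + ((n : ℝ) ^ 4)⁻¹ * blockSum n (fun y => latticeGreen (n • u + p - y) / 2) u|
      ≤ 810 * (8 * (2 * free.U + 2 * c4 + free.Bgrad)) :=
  sum_box_abs_blockAvg_fwdDiff₂_le_doubledBlock (P := fun z => latticeGreen z / 2) μ ν (fun z => letterDiff_free μ z) hn u

end Summit.QuantumFields.BalabanUV.Beta.FP.BlockAveragedKernelWindow

end
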